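import Summits.BirchSwinnertonDyer.BirchSwinnertonDyer.Theses.ErratumRoadFive
import Literature.NumberTheory.EllipticCurves.BigRepModuleShapiroDualityProofs
import HarnessLib

/-!
# Route `ErratumRoadFive`: the item `SUShapiroBigSelmer` CLOSED by name — its Literature constant is a tree THEOREM

Item stmt-BirchSwinnertonDyer-20430 (support) of route `ErratumRoadFive` is, by name, the Literature constant behind
`Summit.BirchSwinnertonDyer.BirchSwinnertonDyer.Theses.ErratumRoadFive.SUShapiroBigSelmer` (Skinner–Urban 2014 Prop. 3.2.3: the Shapiro identification of the anticyclotomic Selmer dual with the big-representation Selmer dual). That named fact is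
DISCHARGED in the tree: `Literature.NumberTheory.EllipticCurves.SkinnerUrban2014.prop323_XAc_equiv_XBigDecomp_holds`
(module `Literature.NumberTheory.EllipticCurves.BigRepModuleShapiroDualityProofs`). This file only restates that theorem at the FULLY-QUALIFIED item type, so the
ledger item closes `proved`; nothing is asserted, no hypothesis, no new declaration besides the
alias theorem.

Honest framing: closes ONE cite-only published-input item of a route of `BirchSwinnertonDyer` by
name; no crux; no label or count of any partition moves; BSD is proved for no curve by this file.
Prepared by cell `bsd-eis`, seat `bsd-eis-k5-ty` g14 (literature-prover / typer; BSD-wide scan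
«open item whose Literature constant already has a `_holds`»), for a PROVER of the owning cell to
file. [cite: SkinnerUrban2014, Prop. 3.2.3 with §3.1.2 and §3.2.1–3.2.2 (pp. 16–18, 21–22)]
-/

set_option autoImplicit false
set_option linter.dupNamespace false

namespace Summit.BirchSwinnertonDyer.BirchSwinnertonDyer.Theorems

/-- **Item `ErratumRoadFive.SUShapiroBigSelmer` holds**, by the Literature theorem
`Literature.NumberTheory.EllipticCurves.SkinnerUrban2014.prop323_XAc_equiv_XBigDecomp_holds`. [cite: SkinnerUrban2014, Prop. 3.2.3 with §3.1.2 and §3.2.1–3.2.2 (pp. 16–18, 21–22)] -/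
theorem erratumRoadFive_sUShapiroBigSelmer_holds :
    Summit.BirchSwinnertonDyer.BirchSwinnertonDyer.Theses.ErratumRoadFive.SUShapiroBigSelmer :=
  Literature.NumberTheory.EllipticCurves.SkinnerUrban2014.prop323_XAc_equiv_XBigDecomp_holds

end Summit.BirchSwinnertonDyer.BirchSwinnertonDyer.Theorems
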